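import Mathlib
import HarnessLib

/-!
# Pollard's theorem on `t`-representable sums in `ℤ/pℤ`

Topic: `Literature/Combinatorics/Additive`.  Cell `mm-stpp` (D-0046), seat `mm-stpp-lit` (gen 4):
the printed theorem behind the prime-order form `U11-P` of the multi-representation packing rule for
STPP families (`HOME/mm-stpp-lit/POLLARD-KILLS.md`).

**Theorem (Pollard 1974).**  Let `p` be a prime, `A, B ⊆ ℤ/pℤ` non-empty, and
`1 ≤ t ≤ min(|A|, |B|)`.  Writing `r(x) = #{(a,b) ∈ A × B : a + b = x}` and `N_i` for the number
of `x` with `r(x) ≥ i`, one has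

  `N_1 + N_2 + ⋯ + N_t = ∑_x min(t, r(x)) ≥ min(t·p, t·(|A| + |B| − t))`.

The case `t = 1` is the Cauchy–Davenport theorem.  We follow Nathanson's proof (induction on `|B|`
through the pair `(A ∪ B, A ∩ B)` after normalising `0 ∈ A ∩ B`, `B ⊄ A`), stated with the sum
`∑_x min(t, r(x))`; the identity with `N_1 + ⋯ + N_t` is `Pollard.sum_min_rep_eq_sum_card_le`.

* `Literature.Combinatorics.Additive.Pollard.rep` — the representation function `r_{A,B}`;
* `Literature.Combinatorics.Additive.pollard` — the theorem for `t ≤ min(|A|,|B|)`;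
* `Literature.Combinatorics.Additive.pollard_of_card_le` — the printed form with `|B| ≤ |A|`.

Mathlib (as pinned) has Cauchy–Davenport (`ZMod.cauchy_davenport`, `Finset.min_le_card_add`) but not
Pollard's theorem; the tree has Kneser (`Literature/Combinatorics/Additive/Kneser.lean`) and
Kemperman–Scherk (`KempermanScherk.lean`).

## References
* J. M. Pollard, *A generalisation of the theorem of Cauchy and Davenport*, J. London Math. Soc.
  (2) 8 (1974) 460–462 [cite: Pollard1974, Thm 1].
* M. B. Nathanson, *Additive Number Theory: Inverse Problems and the Geometry of Sumsets*, GTM 165,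
  Springer 1996, Theorem 2.4 (§2.3, p. 47) and its proof [cite: Nathanson1996, Thm 2.4].
* D. J. Grynkiewicz, *On extending Pollard's theorem for t-representable sums*, Israel J. Math. 177
  (2010) 413–439, Theorem B (statement) [cite: Grynkiewicz2010, Thm B].
-/

namespace Literature.Combinatorics.Additive

open Finset

variable {G : Type*} [AddCommGroup G] [DecidableEq G]

namespace Pollard

/-- The representation function `r_{A,B}(x) = #{(a,b) ∈ A × B : a + b = x}` of Nathanson's proof of
Pollard's theorem. [cite: Nathanson1996, Thm 2.4 (proof, §2.3 p. 47)] -/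
def rep (A B : Finset G) (x : G) : ℕ := ((A ×ˢ B).filter (fun ab => ab.1 + ab.2 = x)).card

/-- Unfolding lemma for `rep`. [cite: Nathanson1996, Thm 2.4 (proof)] -/
theorem rep_def (A B : Finset G) (x : G) :
    rep A B x = ((A ×ˢ B).filter (fun ab => ab.1 + ab.2 = x)).card := rfl

/-- `r_{A,B}(x)` counted through the second coordinate: `#{b ∈ B : x - b ∈ A}`.
[cite: Nathanson1996, Thm 2.4 (proof)] -/
theorem rep_eq_card_filter_right (A B : Finset G) (x : G) :
    rep A B x = (B.filter (fun b => x - b ∈ A)).card := by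
  unfold rep
  refine card_bij (fun ab _ => ab.2) ?_ ?_ ?_
  · intro ab hab
    simp only [mem_filter, mem_product] at hab ⊢
    refine ⟨hab.1.2, ?_⟩
    rw [← hab.2, add_sub_cancel_right]
    exact hab.1.1
  · intro ab hab ab' hab' h
    simp only [mem_filter, mem_product] at hab hab'
    have h1 : ab.1 = ab'.1 := by
      have e1 : ab.1 = x - ab.2 := by rw [← hab.2, add_sub_cancel_right]
      have e2 : ab'.1 = x - ab'.2 := by rw [← hab'.2, add_sub_cancel_right]
      rw [e1, e2, h]
    exact Prod.ext h1 h
  · intro b hb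
    simp only [mem_filter] at hb
    refine ⟨(x - b, b), ?_, rfl⟩
    simp only [mem_filter, mem_product]
    exact ⟨⟨hb.2, hb.1⟩, sub_add_cancel x b⟩

/-- `r_{A,B}(x) ≤ |B|` ("`r_{A,B}(x) ≤ ℓ` for all `x`" in Nathanson's proof). [cite: Nathanson1996, Thm 2.4 (proof)] -/
theorem rep_le_card_right (A B : Finset G) (x : G) : rep A B x ≤ B.card := by
  rw [rep_eq_card_filter_right]
  exact card_filter_le _ _

/-- Symmetry `r_{A,B} = r_{B,A}` (the group is abelian). [cite: Nathanson1996, Thm 2.4 (proof)] -/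
theorem rep_comm (A B : Finset G) (x : G) : rep A B x = rep B A x := by
  unfold rep
  refine card_bij (fun ab _ => (ab.2, ab.1)) ?_ ?_ ?_
  · intro ab hab
    simp only [mem_filter, mem_product] at hab ⊢
    exact ⟨⟨hab.1.2, hab.1.1⟩, by rw [add_comm]; exact hab.2⟩
  · intro ab _ ab' _ h
    simp only [Prod.mk.injEq] at h
    exact Prod.ext h.2 h.1
  · intro ab hab
    simp only [mem_filter, mem_product] at hab
    exact ⟨(ab.2, ab.1), by
      simp only [mem_filter, mem_product]
      exact ⟨⟨hab.1.2, hab.1.1⟩, by rw [add_comm]; exact hab.2⟩, rfl⟩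

/-- `r_{A,B}(x) ≤ |A|`. [cite: Nathanson1996, Thm 2.4 (proof)] -/
theorem rep_le_card_left (A B : Finset G) (x : G) : rep A B x ≤ A.card := by
  rw [rep_comm]; exact rep_le_card_right B A x

/-- Monotonicity in the second set (`S(A,B,t) ≥ S(A,B',t)` for `B' ⊆ B` in Nathanson's proof).
[cite: Nathanson1996, Thm 2.4 (proof)] -/
theorem rep_mono_right (A : Finset G) {B B' : Finset G} (h : B' ⊆ B) (x : G) :
    rep A B' x ≤ rep A B x := by
  unfold rep
  exact card_le_card (filter_subset_filter _ (product_subset_product (Subset.refl _) h))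

/-- Additivity in the first set over a disjoint union. [cite: Nathanson1996, Thm 2.4 (proof)] -/
theorem rep_union_left {A₁ A₂ : Finset G} (h : Disjoint A₁ A₂) (B : Finset G) (x : G) :
    rep (A₁ ∪ A₂) B x = rep A₁ B x + rep A₂ B x := by
  unfold rep
  rw [union_product, filter_union, card_union_of_disjoint]
  exact disjoint_filter_filter (disjoint_product.mpr (Or.inl h))

/-- Additivity in the second set over a disjoint union. [cite: Nathanson1996, Thm 2.4 (proof)] -/
theorem rep_union_right (A : Finset G) {B₁ B₂ : Finset G} (h : Disjoint B₁ B₂) (x : G) :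
    rep A (B₁ ∪ B₂) x = rep A B₁ x + rep A B₂ x := by
  rw [rep_comm, rep_union_left h, rep_comm B₁, rep_comm B₂]

/-- `∑_x r_{A,B}(x) = |A|·|B|` (over a finite ambient group; "`S(A,B,ℓ) = kℓ`").
[cite: Nathanson1996, Thm 2.4 (proof)] -/
theorem sum_rep [Fintype G] (A B : Finset G) : ∑ x, rep A B x = A.card * B.card := by
  unfold rep
  rw [← card_product]
  exact (card_eq_sum_card_fiberwise (s := A ×ˢ B) (t := (univ : Finset G))
    (f := fun ab => ab.1 + ab.2) (fun _ _ => mem_univ _)).symm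

/-- Translation invariance of the representation function ("replacing `B` with `B - b`, `A` with
`A - a*`" in Nathanson's proof). [cite: Nathanson1996, Thm 2.4 (proof)] -/
theorem rep_image_add (A B : Finset G) (u v x : G) :
    rep (A.image (· + u)) (B.image (· + v)) (x + (u + v)) = rep A B x := by
  rw [rep_eq_card_filter_right, rep_eq_card_filter_right]
  have hinj : Function.Injective (fun b : G => b + v) := fun b b' hb => add_right_cancel hb
  rw [filter_image, card_image_of_injective _ hinj]
  congr 1
  ext b
  simp only [mem_filter, mem_image, and_congr_right_iff]
  intro _
  constructor
  · rintro ⟨a, ha, hau⟩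
    have : a = x - b := by
      have h1 : a = x + (u + v) - (b + v) - u := by rw [← hau]; abel
      rw [h1]; abel
    rw [← this]; exact ha
  · intro hx
    exact ⟨x - b, hx, by abel⟩

/-- Translation invariance of `∑_x min(t, r(x))`. [cite: Nathanson1996, Thm 2.4 (proof)] -/
theorem sum_min_rep_image_add [Fintype G] (A B : Finset G) (u v : G) (t : ℕ) :
    ∑ x, min t (rep (A.image (· + u)) (B.image (· + v)) x) = ∑ x, min t (rep A B x) := by
  rw [← Equiv.sum_comp (Equiv.addRight (u + v))]
  refine Fintype.sum_congr _ _ (fun x => ?_)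
  simp only [Equiv.coe_addRight, rep_image_add]

/-- The Dyson/Nathanson decomposition `r_{A,B} = r_{A∪B, A∩B} + r_{A∖B, B∖A}`
(Nathanson 1996, proof of Thm 2.4: representation types (ii)–(iv) versus type (i)).
[cite: Nathanson1996, Thm 2.4 (proof)] -/
theorem rep_eq_rep_union_inter_add (A B : Finset G) (x : G) :
    rep A B x = rep (A ∪ B) (A ∩ B) x + rep (A \ B) (B \ A) x := by
  -- write `A = (A \ B) ∪ (A ∩ B)`, `B = (B \ A) ∪ (A ∩ B)`, `A ∪ B = (A \ B) ∪ (B \ A) ∪ (A ∩ B)`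
  have hA : A = (A \ B) ∪ (A ∩ B) := by
    ext a; simp only [mem_union, mem_sdiff, mem_inter]; tauto
  have hB : B = (B \ A) ∪ (A ∩ B) := by
    ext b; simp only [mem_union, mem_sdiff, mem_inter]; tauto
  have hU : A ∪ B = ((A \ B) ∪ (B \ A)) ∪ (A ∩ B) := by
    ext c; simp only [mem_union, mem_sdiff, mem_inter]; tauto
  have d1 : Disjoint (A \ B) (A ∩ B) := by
    rw [disjoint_left]; intro a ha hb
    exact (mem_sdiff.1 ha).2 (mem_inter.1 hb).2
  have d2 : Disjoint (B \ A) (A ∩ B) := by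
    rw [disjoint_left]; intro a ha hb
    exact (mem_sdiff.1 ha).2 (mem_inter.1 hb).1
  have d3 : Disjoint (A \ B) (B \ A) := by
    rw [disjoint_left]; intro a ha hb
    exact (mem_sdiff.1 hb).2 (mem_sdiff.1 ha).1
  have d4 : Disjoint ((A \ B) ∪ (B \ A)) (A ∩ B) := disjoint_union_left.2 ⟨d1, d2⟩
  have e1 : rep (A \ B ∪ A ∩ B) (B \ A ∪ A ∩ B) x = rep A B x := by rw [← hA, ← hB]
  rw [← e1, hU, rep_union_left d1, rep_union_right _ d2, rep_union_right _ d2,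
    rep_union_left d4, rep_union_left d3, rep_comm (A ∩ B) (B \ A)]
  ring

/-- `∑_x min(t, r(x)) = N_1 + ⋯ + N_t`, where `N_i = #{x : r(x) ≥ i}` (the printed left side:
"`S(A,B,t) = N_1 + N_2 + ⋯ + N_t = ∑_x min(t, r_{A,B}(x))`"). [cite: Nathanson1996, Thm 2.4 (proof)] -/
theorem sum_min_rep_eq_sum_card_le [Fintype G] (A B : Finset G) (t : ℕ) :
    ∑ x, min t (rep A B x) = ∑ i ∈ Icc 1 t, (univ.filter (fun x : G => i ≤ rep A B x)).card := by
  have key : ∀ x : G, min t (rep A B x) = ∑ i ∈ Icc 1 t, if i ≤ rep A B x then 1 else 0 := by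
    intro x
    rw [sum_boole, Nat.cast_id]
    have : (Icc 1 t).filter (fun i => i ≤ rep A B x) = Icc 1 (min t (rep A B x)) := by
      ext i; simp only [mem_filter, mem_Icc, le_min_iff]; tauto
    rw [this, Nat.card_Icc]
    omega
  simp_rw [key]
  rw [sum_comm]
  refine sum_congr rfl (fun i _ => ?_)
  rw [card_filter, sum_boole, Nat.cast_id, card_filter]

end Pollard

open Pollard

/-- If a non-empty `A ⊆ ℤ/pℤ` is stable under `a ↦ a + b` with `b ≠ 0`, then `A` is everything
("if `a + b* ∈ A` for every `a ∈ A`, then … `A = ℤ/pℤ`" in Nathanson's proof).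
[cite: Nathanson1996, Thm 2.4 (proof)] -/
theorem Pollard.eq_univ_of_add_mem {p : ℕ} [Fact p.Prime] {A : Finset (ZMod p)} (hA : A.Nonempty)
    {b : ZMod p} (hb : b ≠ 0) (h : ∀ a ∈ A, a + b ∈ A) : A = univ := by
  obtain ⟨a₀, ha₀⟩ := hA
  have hmem : ∀ n : ℕ, a₀ + (n : ZMod p) * b ∈ A := by
    intro n
    induction n with
    | zero => simpa using ha₀
    | succ n ih =>
      have := h _ ih
      rwa [Nat.cast_succ, add_mul, one_mul, ← add_assoc]
  -- the `p` elements `a₀ + n b`, `n < p`, are distinct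
  have hinj : Set.InjOn (fun n : ℕ => a₀ + (n : ZMod p) * b) (Set.Iio p) := by
    intro n hn m hm hnm
    simp only at hnm
    have h1 : (n : ZMod p) * b = (m : ZMod p) * b := add_left_cancel hnm
    have h2 : (n : ZMod p) = (m : ZMod p) := mul_right_cancel₀ hb h1
    have h3 := congrArg ZMod.val h2
    rwa [ZMod.val_natCast, ZMod.val_natCast, Nat.mod_eq_of_lt (Set.mem_Iio.1 hn),
      Nat.mod_eq_of_lt (Set.mem_Iio.1 hm)] at h3
  have hcard : p ≤ A.card := by
    have hsub : (range p).image (fun n : ℕ => a₀ + (n : ZMod p) * b) ⊆ A := by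
      intro x hx
      obtain ⟨n, _, rfl⟩ := mem_image.1 hx
      exact hmem n
    have := card_le_card hsub
    rwa [card_image_of_injOn (by simpa [coe_range] using hinj), card_range] at this
  apply eq_univ_of_card
  rw [ZMod.card]
  exact le_antisymm (by simpa [ZMod.card] using card_le_univ A) hcard

/-- **Pollard's theorem, printed form** (`ℓ = |B| ≤ |A| = k`, `1 ≤ t ≤ ℓ`): the inductive core of
Nathanson's proof, by strong induction on `|B|`. [cite: Pollard1974, Thm 1]
[cite: Nathanson1996, Thm 2.4] -/
theorem pollard_of_card_le {p : ℕ} [Fact p.Prime] :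
    ∀ (n : ℕ) (A B : Finset (ZMod p)) (t : ℕ), B.card = n → B.card ≤ A.card → 1 ≤ t →
      t ≤ B.card → t * min p (A.card + B.card - t) ≤ ∑ x, min t (rep A B x) := by
  intro n
  induction n using Nat.strong_induction_on with
  | _ n ih =>
  intro A B t hBn hBA ht1 htB
  have hp : Fintype.card (ZMod p) = p := ZMod.card p
  have hAp : A.card ≤ p := by simpa [hp] using card_le_univ A
  -- Case `t = |B|`: the sum is `|A|·|B|`.
  rcases eq_or_lt_of_le htB with rfl | htB'
  · have hsum : ∑ x, min B.card (rep A B x) = ∑ x, rep A B x :=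
      Fintype.sum_congr _ _ (fun x => min_eq_right (rep_le_card_right A B x))
    rw [hsum, sum_rep]
    calc B.card * min p (A.card + B.card - B.card) ≤ B.card * A.card :=
          Nat.mul_le_mul_left _ ((min_le_right _ _).trans (by omega))
      _ = A.card * B.card := mul_comm _ _
  -- Now `1 ≤ t < |B|`, so `|B| ≥ 2`.
  have hB2 : 2 ≤ B.card := by omega
  by_cases hbig : p < A.card + B.card - t
  · -- shrink `B` to `B'` with `|B'| = p - |A| + t`; then `|A| + |B'| - t = p`
    have hle : p - A.card + t ≤ B.card := by omega
    obtain ⟨B', hB'B, hB'card⟩ := exists_subset_card_eq hle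
    have hB'lt : B'.card < n := by omega
    have hmono : ∑ x, min t (rep A B' x) ≤ ∑ x, min t (rep A B x) :=
      sum_le_sum (fun x _ => min_le_min_left _ (rep_mono_right A hB'B x))
    have hIH := ih B'.card hB'lt A B' t rfl (by omega) ht1 (by omega)
    have hval : A.card + B'.card - t = p := by omega
    rw [hval, min_self] at hIH
    calc t * min p (A.card + B.card - t) ≤ t * p := Nat.mul_le_mul_left _ (min_le_left _ _)
      _ ≤ _ := hIH.trans hmono
  · -- main case `|A| + |B| - t ≤ p`; then `|A| < p`
    have hsmall : A.card + B.card - t ≤ p := by omega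
    have hAlt : A.card < p := by omega
    have hgoal : min p (A.card + B.card - t) = A.card + B.card - t := min_eq_right hsmall
    rw [hgoal]
    -- pick `b₁ ≠ b₂` in `B`, let `b⋆ = b₂ - b₁ ≠ 0`, and `a⋆ ∈ A` with `a⋆ + b⋆ ∉ A`
    obtain ⟨b₁, hb₁, b₂, hb₂, hb12⟩ := one_lt_card.1 (by omega : 1 < B.card)
    set bs := b₂ - b₁ with hbs
    have hbs0 : bs ≠ 0 := fun h => hb12 (by rw [hbs, sub_eq_zero] at h; exact h.symm)
    have hAne : A.Nonempty := card_pos.1 (by omega)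
    have hex : ∃ a ∈ A, a + bs ∉ A := by
      by_contra hcon
      simp only [not_exists, not_and, not_not] at hcon
      have := Pollard.eq_univ_of_add_mem hAne hbs0 hcon
      rw [this, card_univ, hp] at hAlt
      exact lt_irrefl _ hAlt
    obtain ⟨as, has, hasbs⟩ := hex
    -- translate: `A₀ = A - a⋆`, `B₀ = B - b₁`; `0 ∈ A₀ ∩ B₀`, `b⋆ ∈ B₀ \ A₀`
    set A₀ := A.image (· + -as) with hA₀
    set B₀ := B.image (· + -b₁) with hB₀
    have hinjA : Function.Injective (fun a : ZMod p => a + -as) := fun a b h => add_right_cancel h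
    have hinjB : Function.Injective (fun b : ZMod p => b + -b₁) := fun a b h => add_right_cancel h
    have hA₀card : A₀.card = A.card := card_image_of_injective _ hinjA
    have hB₀card : B₀.card = B.card := card_image_of_injective _ hinjB
    have hsumeq : ∑ x, min t (rep A B x) = ∑ x, min t (rep A₀ B₀ x) :=
      (sum_min_rep_image_add A B (-as) (-b₁) t).symm
    rw [hsumeq, ← hA₀card, ← hB₀card]
    have h0A : (0 : ZMod p) ∈ A₀ := mem_image.2 ⟨as, has, by simp⟩
    have h0B : (0 : ZMod p) ∈ B₀ := mem_image.2 ⟨b₁, hb₁, by simp⟩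
    have hbsB : bs ∈ B₀ := mem_image.2 ⟨b₂, hb₂, by rw [hbs, sub_eq_add_neg]⟩
    have hbsA : bs ∉ A₀ := by
      intro hmem
      obtain ⟨a, ha, hab⟩ := mem_image.1 hmem
      have : a = as + bs := by
        have e : a = bs + as := by rw [← hab]; abel
        rw [e, add_comm]
      exact hasbs (this ▸ ha)
    -- the pair `(U, I)`
    set U := A₀ ∪ B₀ with hU
    set I := A₀ ∩ B₀ with hI
    have hIpos : 1 ≤ I.card := card_pos.2 ⟨0, mem_inter.2 ⟨h0A, h0B⟩⟩
    have hIlt : I.card < B₀.card := by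
      apply card_lt_card
      refine ⟨inter_subset_right, fun hsub => hbsA ?_⟩
      exact (mem_inter.1 (hsub hbsB)).1
    have hUI : U.card + I.card = A₀.card + B₀.card := card_union_add_card_inter _ _
    have hIU : I.card ≤ U.card := card_le_card (inter_subset_left.trans subset_union_left)
    have hUp : U.card ≤ p := by simpa [hp] using card_le_univ U
    have hB₀n : B₀.card = n := by rw [hB₀card]; exact hBn
    have htB₀ : t < B₀.card := by rw [hB₀card]; exact htB'
    -- pointwise decomposition
    have hdec : ∀ x, rep A₀ B₀ x = rep U I x + rep (A₀ \ B₀) (B₀ \ A₀) x :=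
      fun x => rep_eq_rep_union_inter_add A₀ B₀ x
    by_cases htI : t ≤ I.card
    · -- Case `t ≤ |I|`: compare with `(U, I)` directly
      have hIH := ih I.card (by omega) U I t rfl hIU ht1 htI
      have hval : U.card + I.card - t = A₀.card + B₀.card - t := by rw [hUI]
      rw [hval, min_eq_right (by omega)] at hIH
      refine hIH.trans (sum_le_sum (fun x _ => min_le_min_left _ ?_))
      rw [hdec x]; exact Nat.le_add_right _ _
    · -- Case `|I| < t < |B|`: `min(t, r) ≥ r_{U,I} + min(t - |I|, r_{A',B'})`
      have htI : I.card < t := not_le.1 htI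
      set t' := t - I.card with ht'
      set A' := A₀ \ B₀ with hA'
      set B' := B₀ \ A₀ with hB'
      have hA'card : A'.card = A₀.card - I.card := by
        have := card_sdiff_add_card_inter A₀ B₀
        rw [← hA', ← hI] at this
        omega
      have hB'card : B'.card = B₀.card - I.card := by
        have := card_sdiff_add_card_inter B₀ A₀
        rw [← hB', inter_comm, ← hI] at this
        omega
      have hpt : ∀ x, rep U I x + min t' (rep A' B' x) ≤ min t (rep A₀ B₀ x) := by
        intro x
        rw [hdec x]
        have hr : rep U I x ≤ I.card := rep_le_card_right U I x
        rcases le_total (rep A' B' x) t' with h | h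
        · rw [min_eq_right h, min_eq_right (by omega)]
        · rw [min_eq_left h]
          exact le_min (by omega) (Nat.add_le_add_left h _)
      have hIH := ih B'.card (by omega) A' B' t' rfl (by omega) (by omega) (by omega)
      have hval : min p (A'.card + B'.card - t') = U.card - t := by
        rw [min_eq_right (by omega)]; omega
      rw [hval] at hIH
      have hsumUI : ∑ x, rep U I x = U.card * I.card := sum_rep U I
      calc t * (A₀.card + B₀.card - t)
          = U.card * I.card + t' * (U.card - t) := by
            rw [← hUI, ht']
            zify [htI.le, (show t ≤ U.card by omega), (show t ≤ U.card + I.card by omega)]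
            ring
        _ ≤ ∑ x, rep U I x + ∑ x, min t' (rep A' B' x) := by
            rw [hsumUI]; exact Nat.add_le_add_left hIH _
        _ = ∑ x, (rep U I x + min t' (rep A' B' x)) := (sum_add_distrib).symm
        _ ≤ ∑ x, min t (rep A₀ B₀ x) := sum_le_sum (fun x _ => hpt x)

/-- **Pollard's theorem** (Pollard 1974; Nathanson 1996, Thm 2.4).  For a prime `p`, finite
`A, B ⊆ ℤ/pℤ` and `1 ≤ t ≤ min(|A|, |B|)`:
`∑_x min(t, r_{A,B}(x)) ≥ min(t·p, t·(|A| + |B| − t))`, i.e. `N_1 + ⋯ + N_t ≥ t·min(p, |A|+|B|−t)`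
with `N_i = #{x : r_{A,B}(x) ≥ i}` (see `Pollard.sum_min_rep_eq_sum_card_le`).
[cite: Pollard1974, Thm 1] [cite: Nathanson1996, Thm 2.4] -/
theorem pollard {p : ℕ} [Fact p.Prime] (A B : Finset (ZMod p)) {t : ℕ} (ht1 : 1 ≤ t)
    (htA : t ≤ A.card) (htB : t ≤ B.card) :
    t * min p (A.card + B.card - t) ≤ ∑ x, min t (rep A B x) := by
  rcases le_total B.card A.card with h | h
  · exact pollard_of_card_le B.card A B t rfl h ht1 htB
  · have := pollard_of_card_le A.card B A t rfl h ht1 htA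
    rw [add_comm B.card] at this
    refine this.trans (le_of_eq (Fintype.sum_congr _ _ (fun x => by rw [rep_comm])))

/-- Pollard's theorem in the printed `N_1 + ⋯ + N_t` form. [cite: Pollard1974, Thm 1] -/
theorem pollard_sum_card_le {p : ℕ} [Fact p.Prime] (A B : Finset (ZMod p)) {t : ℕ} (ht1 : 1 ≤ t)
    (htA : t ≤ A.card) (htB : t ≤ B.card) :
    t * min p (A.card + B.card - t) ≤
      ∑ i ∈ Icc 1 t, (univ.filter (fun x : ZMod p => i ≤ rep A B x)).card := by
  rw [← sum_min_rep_eq_sum_card_le]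
  exact pollard A B ht1 htA htB

end Literature.Combinatorics.Additive
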